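import Literature.MathematicalPhysics.QuantumFieldTheory.Balaban1983to89.B9Eq3132EnergyOfTents
import Literature.MathematicalPhysics.QuantumFieldTheory.Balaban1983to89.B9Eq335CoverageAtLettersY

/-!
# `Balaban1983to89.B9Eq3132TentPlaquettes` — T. Bałaban, *Propagators for lattice gauge theories in a background field*, Commun. Math. Phys. **99** (1985) 389–434
# [Balaban1985BackgroundPropagators], (3.35) p. 396 with (3.69) p. 404: THE BASE-BLOCK PLAQUETTE HYPOTHESIS (hP) OF ROW 26's ENERGY BOUND HOLDS FOR EVERY
# (3.35)-REGULAR BACKGROUND — the base block `Bʲ(base y)` of an index bond lies in ONE class cube of index `j` (its big `j`-block), so n06-j's plaquette estimate applies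
# with the scale `Lʲη`: `|U(∂p) − 1| ≤ 2C(1+C)e^{4C}·(Lʲ)⁻²`, `C = c·M·α₀`

statement-level skeleton of published theorems with citation tags; proofs where landed; nothing here is a claim about the Yang–Mills mass gap

THE PRINT.  p. 396 (3.35) (the cube class and the small-field gauge); p. 404 (3.69) («the estimates follow directly from the assumptions (3.35)»); [4] (2.3) p. 224 (`Λ_j`).

WHY THIS FILE (dag-n06-i gen 14, N06 bundle F4, row 26).  `B9Eq3132EnergyOfTents.hP1_of_transport` reduces row 26's `hP1` to (hW) ∧ (hP).  THIS FILE discharges (hP) from the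
member's typed class (3.35) (`bg9K.Reg335`, def-Y's `cubeClass396`): every site of `Bʲ(base y)` has level `j` (`B6Ineq2142KLevelV1.lev_eq_of_base`), all of them share the
big-`j`-block label of any one of them (nested grids: `bigSide j = Lʲ·(M_hL)`), so n06-j's `B9Eq335CoverageAtLettersY.exists_cubeClass396_block` provides a class cube of index
`j` containing the whole base block, and `B9Eq335PlaquetteAtLettersY.norm_holY_sub_one_le_of_reg335` gives the bound.  Constants: `ϖ(C) = 2C(1+C)e^{4C}` is monotone in
`C ≥ 0`, so below a threshold `M·α₀ ≤ aT` one member-uniform `ϖ` serves; a negative class constant makes (3.35) unsatisfiable (`reg335_const_nonneg`).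

WHAT IS PROVED (sorry-free, 0 def).
* §1 `blk_eq_of_mem_baseBlk` (base-block sites share the big-`j`-block label), ★ `exists_cubeClass396_baseBlk` (a class cube of index `j` containing `Bʲ(base y)`),
  `reg335_const_nonneg` (a regular background forces `0 < c·M·α₀`), `plaqBound_mono`.
* §2 ★★★ `plaqSmall_of_reg335` (KIdx level, any `G`, `N ≥ 1`), ★★★ `plaqSmall_member_of_reg335` (member level, `M·α₀ ≤ aT`, uniform `ϖ = 2C₀(1+C₀)e^{4C₀}`, `C₀ = c·aT`).
* §4 (v1.1, appended) `basePlaqSmall_mono`.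

HONEST SCOPE.  Lattice bookkeeping on def-Y's class + n06-j's estimate by name; nothing of [B9] asserted; count-neutral; N06 NOT discharged.  Cell `pub-ymgap` (HUMAN RULING
D-0062), Track A node N06 [B9], seat `pub-ymgap-dag-n06-i` (gen 14), 2026-08-27; a NEW file.
-/

noncomputable section

namespace Literature.MathematicalPhysics.QuantumFieldTheory.Balaban1983to89.B9Eq3132TentPlaquettes

open Node00
open B6KLevelCensusIndexV1 (KIdx kGeo)
open B6GlobalChartV1 (PV domT toBox)
open B6Ineq2142KLevelV1 (lvl base)
open B5Eq118OneStroke (iterBlock mem_iterBlock mem_iterBlock_iff)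
open B9BackgroundsKLevelV1 (bg9K cubeClass396 levV1 reg335Cube_of_reg335 cubeClass396_nonempty exists_mem_cubeClass396)
open B9Eq335PlaquetteAtLettersY (norm_holY_sub_one_le_of_reg335 eta_pos one_le_L)
open B9Eq335CoverageAtLettersY (exists_cubeClass396_block)
open B9Eq3132TentBumps (baseBlk sideY)
open B9Eq3132EnergyOfTents (BasePlaqSmall BaseLassoSmall)
open B9PinMembersKLevelV1 (MemberY geo9Y bg9Y)
open B7Prop2SpecialUnitary (specialUnitaryUnits)
open scoped Matrix Matrix.Norms.L2Operator

variable {N : ℕ} {d ℓ : ℕ} {hd : 1 ≤ d + 1} {hL : Odd (ℓ + 1) ∧ 1 < ℓ + 1} {b₀ b₁ : ℝ} (i : KIdx d ℓ hd hL b₀ b₁)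

/-! ## §1 The base block sits in one class cube of its own index -/

/-- **BASE-BLOCK SITES SHARE THE BIG-`j`-BLOCK LABEL**: for `z, z′ ∈ Bʲ(base y)`, `blk (bigSide j) z = blk (bigSide j) z′` (nested grids, `bigSide j = Lʲ·(M_hL)`).
[cite: Balaban1984PropagatorsII, (2.1) p.224 («Ω_j … is a sum of big blocks»); Balaban1985BackgroundPropagators, p.396] -/
theorem blk_eq_of_mem_baseBlk (y : IBondY i) {z z' : Site (PV d ℓ i.m i.K hd hL) 0} (hz : z ∈ baseBlk i y) (hz' : z' ∈ baseBlk i y) :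
    B4Reflection242.blk (B6MultiLevelBoxOperator.bigSide ℓ i.Mh (lvl i.hN i.D i.hk y)) (toBox i.hN z).1 =
      B4Reflection242.blk (B6MultiLevelBoxOperator.bigSide ℓ i.Mh (lvl i.hN i.D i.hk y)) (toBox i.hN z').1 := by
  rw [B9BackgroundsKLevelV1.blk_toBox_eq_iff]
  intro μ
  have h1 := (mem_iterBlock_iff (B6Ineq2142KLevelV1.lvl_le_mK i.hN i.D i.hk y) _ z).1 hz μ
  have h2 := (mem_iterBlock_iff (B6Ineq2142KLevelV1.lvl_le_mK i.hN i.D i.hk y) _ z').1 hz' μ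
  have hL' : (PV d ℓ i.m i.K hd hL).L = ℓ + 1 := rfl
  rw [hL'] at h1 h2
  rw [B6MultiLevelBoxOperator.bigSide_eq, ← Nat.div_div_eq_div_mul (z μ).val ((ℓ + 1) ^ lvl i.hN i.D i.hk y) (i.Mh * (ℓ + 1)),
    ← Nat.div_div_eq_div_mul (z' μ).val ((ℓ + 1) ^ lvl i.hN i.D i.hk y) (i.Mh * (ℓ + 1)), h1, h2]

/-- every base-block site has level `j`. [cite: Balaban1984PropagatorsII, (2.3)–(2.4) p.224] -/
theorem levV1_eq_of_mem_baseBlk (y : IBondY i) {z : Site (PV d ℓ i.m i.K hd hL) 0} (hz : z ∈ baseBlk i y) : levV1 i z = lvl i.hN i.D i.hk y :=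
  B6Ineq2142KLevelV1.lev_eq_of_base i.hN i.D i.hk (B9GeoLemma21KLevelV1.one_le_k i) y ((mem_iterBlock _ _ _).1 hz)

/-- ★ **A CLASS CUBE OF INDEX `j` CONTAINS THE WHOLE BASE BLOCK** (the big `j`-block of any of its sites). [cite: Balaban1985BackgroundPropagators, p.396 (the cube class); Balaban1984PropagatorsII, (2.1) p.224] -/
theorem exists_cubeClass396_baseBlk (y : IBondY i) :
    ∃ q ∈ cubeClass396 i, q.2 = lvl i.hN i.D i.hk y ∧ ∀ z ∈ baseBlk i y, z ∈ q.1 := by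
  set x₀ := B6Ineq2142KLevelV1.baseSite i.hN i.D i.hk y
  have hx₀ : x₀ ∈ baseBlk i y := (mem_iterBlock _ _ _).2 (B6Ineq2142KLevelV1.iterBlockOf_baseSite i.hN i.D i.hk y)
  obtain ⟨q, hq, hq2, hmem⟩ := exists_cubeClass396_block i x₀
  have hlev : levV1 i x₀ = lvl i.hN i.D i.hk y := levV1_eq_of_mem_baseBlk i y hx₀
  refine ⟨q, hq, hq2.trans hlev, fun z hz => hmem z ?_⟩
  rw [hlev]
  exact blk_eq_of_mem_baseBlk i y hz hx₀

/-- a (3.35)-regular background forces a POSITIVE class constant (the class cubes are non-empty and `|A| < C·ξ⁻¹` there).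
[cite: Balaban1985BackgroundPropagators, (3.35) p.396, bookkeeping] -/
theorem reg335_const_pos {𝔸 : Type} [NormedRing 𝔸] [NormedAlgebra ℂ 𝔸] [CompleteSpace 𝔸] {G : Subgroup 𝔸ˣ} {c α₀ : ℝ} {U : CfgY 𝔸 i}
    (h : (bg9K 𝔸 G i).Reg335 c α₀ U) : 0 < c * (kGeo i).M * α₀ := by
  obtain ⟨q, hq, hx⟩ := exists_mem_cubeClass396 i (fun _ => 0)
  obtain ⟨u, A, -, -, hA, -⟩ := reg335Cube_of_reg335 i h hq
  have h1 := hA ⟨0, by show 0 < d + 1; omega⟩ _ hx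
  have hξ : 0 < LatticeNorms.scaleLen (kGeo i).L (kGeo i).eta q.2 := by
    unfold LatticeNorms.scaleLen; exact mul_pos (pow_pos (lt_of_lt_of_le one_pos (one_le_L i)) _) (eta_pos i)
  have h2 : 0 < c * (kGeo i).M * α₀ * (LatticeNorms.scaleLen (kGeo i).L (kGeo i).eta q.2)⁻¹ := lt_of_le_of_lt (norm_nonneg _) h1
  exact (mul_pos_iff_of_pos_right (inv_pos.2 hξ)).1 h2

/-! ## §2 ★★★ (hP) from (3.35) -/

/-- the plaquette constant of (3.69): `ϖ(C) = 2C(1+C)e^{4C}` (n06-j's `B9Eq335PlaquetteAtLettersY`). [cite: Balaban1985BackgroundPropagators, (3.69) p.404, (3.35) p.396] -/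
def varpi (C : ℝ) : ℝ := 2 * C * (1 + C) * Real.exp (4 * C)

omit i in
/-- `ϖ(C) ≥ 0` for `C ≥ 0`. [cite: Balaban1985BackgroundPropagators, (3.69) p.404, bookkeeping] -/
theorem varpi_nonneg {C : ℝ} (hC : 0 ≤ C) : 0 ≤ varpi C := by unfold varpi; positivity

omit i in
/-- `ϖ` is monotone on `C ≥ 0` (n06-j's `plaqBound_mono`, restated for `varpi`). [cite: Balaban1985BackgroundPropagators, (3.69) p.404, bookkeeping] -/
theorem varpi_mono {C C' : ℝ} (hC : 0 ≤ C) (hCC : C ≤ C') : varpi C ≤ varpi C' := by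
  unfold varpi
  have h1 : Real.exp (4 * C) ≤ Real.exp (4 * C') := Real.exp_le_exp.2 (by linarith)
  have h2 : 0 ≤ Real.exp (4 * C) := (Real.exp_pos _).le
  have h3 : 2 * C * (1 + C) ≤ 2 * C' * (1 + C') := by nlinarith
  calc 2 * C * (1 + C) * Real.exp (4 * C) ≤ 2 * C' * (1 + C') * Real.exp (4 * C) := mul_le_mul_of_nonneg_right h3 h2
    _ ≤ 2 * C' * (1 + C') * Real.exp (4 * C') := mul_le_mul_of_nonneg_left h1 (by nlinarith)

/-- `M = L·M_h > 0` for the member. [cite: Balaban1984PropagatorsII, (2.1) p.224, bookkeeping] -/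
theorem M_pos : 0 < (kGeo i).M := (B9BackgroundsKLevelV1.eta_pos_L_one_le_M_pos i).2.2

/-- ★★★ **(hP) FROM (3.35), at a k-level index**: for every `G` and every `(3.35)`-regular `U`, every plaquette with three corners in a base block `Bʲ(base y)` has
`|U(∂p) − 1| ≤ ϖ(cMα₀)·(Lʲ)⁻²` — i.e. `BasePlaqSmall i U (ϖ(cMα₀))`. [cite: Balaban1985BackgroundPropagators, (3.35) p.396, (3.69) p.404] -/
theorem plaqSmall_of_reg335 [Nonempty (Fin N)] {G : Subgroup (Matrix (Fin N) (Fin N) ℂ)ˣ} {c α₀ : ℝ} {U : CfgY (Matrix (Fin N) (Fin N) ℂ) i}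
    (h : (bg9K (Matrix (Fin N) (Fin N) ℂ) G i).Reg335 c α₀ U) : BasePlaqSmall i U (varpi (c * (kGeo i).M * α₀)) := by
  intro y p h1 h2 h3
  obtain ⟨q, hq, hq2, hmem⟩ := exists_cubeClass396_baseBlk i y
  have hC := (reg335_const_pos i h).le
  have key := norm_holY_sub_one_le_of_reg335 i U hC h hq p (hmem _ h1) (hmem _ h2) (hmem _ h3)
  rw [hq2] at key
  exact key

/-- ★★★ **(hP) AT A MEMBER OF def-Y's RECORD, member-uniform**: below the threshold `M·α₀ ≤ aT` (`α₀ > 0`), every background in the member's class (3.35) satisfies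
`BasePlaqSmall x.toKIdx U (ϖ(c·aT))`. [cite: Balaban1985BackgroundPropagators, (3.35) p.396, (3.69) p.404] -/
theorem plaqSmall_member_of_reg335 [Nonempty (Fin N)] {G : Subgroup (Matrix (Fin N) (Fin N) ℂ)ˣ} {Mstar : ℕ} (x : MemberY d ℓ hd hL b₀ b₁ Mstar)
    {c α₀ aT : ℝ} (hα : 0 < α₀) (hMa : (geo9Y x).M * α₀ ≤ aT) {U : (bg9Y (Matrix (Fin N) (Fin N) ℂ) G x).Cfg}
    (h : (bg9Y (Matrix (Fin N) (Fin N) ℂ) G x).Reg335 c α₀ U) : BasePlaqSmall x.toKIdx U (varpi (c * aT)) := by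
  have h1 := plaqSmall_of_reg335 x.toKIdx h.1
  have hpos := reg335_const_pos x.toKIdx h.1
  have hM := M_pos x.toKIdx
  have hc : 0 < c := by
    have : 0 < c * ((kGeo x.toKIdx).M * α₀) := by rw [← mul_assoc]; exact hpos
    exact pos_of_mul_pos_left this (mul_pos hM hα).le
  have hle : c * (kGeo x.toKIdx).M * α₀ ≤ c * aT := by
    rw [mul_assoc]; exact mul_le_mul_of_nonneg_left hMa hc.le
  have hmono : varpi (c * (kGeo x.toKIdx).M * α₀) ≤ varpi (c * aT) := varpi_mono hpos.le hle
  intro y p h₁ h₂ h₃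
  exact (h1 y p h₁ h₂ h₃).trans (mul_le_mul_of_nonneg_right hmono (sq_nonneg _))

/-! ## §3 ★★★ Row 26's `hP1` from the lasso hypothesis (hW) alone -/

/-- at `N = 0` every matrix vanishes, so (hP) holds with any non-negative constant. [cite: Balaban1985BackgroundPropagators, (3.69) p.404, bookkeeping (degenerate fibre)] -/
theorem basePlaqSmall_of_isEmpty [IsEmpty (Fin N)] (U : CfgY (Matrix (Fin N) (Fin N) ℂ) i) {ϖ : ℝ} (hϖ : 0 ≤ ϖ) : BasePlaqSmall i U ϖ := by
  intro y p _ _ _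
  have h0 : ((holY i U p : (Matrix (Fin N) (Fin N) ℂ)ˣ) : Matrix (Fin N) (Fin N) ℂ) - 1 = 0 := Subsingleton.elim _ _
  rw [h0, norm_zero]
  positivity

/-- ★★★ **ROW 26's `hP1` FROM (hW) ALONE**: the certificate's `hP1` (shape of `B9Eq3132CoerciveFromEnergy.hco26_of_energy_step12`, verbatim) from ONE displayed binder — the
member-uniform smallness of the taxicab lassos on the base blocks below a threshold `M·α₀ ≤ aT`; (hP) is supplied here from (3.35).
[cite: Balaban1984PropagatorsII, (2.147) p.248; Balaban1985BackgroundPropagators, (3.132) p.422, (3.35) p.396, (3.69) p.404, (3.40) p.397] -/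
theorem hP1_of_lassoSmall (θ : Stage3Params) (Mstar : ℕ) {c35 : ℝ}
    (hWl : ∃ aT ω : ℝ, 0 < aT ∧
      ∀ x : MemberY θ.d₆ θ.ℓ₆ θ.hd' θ.hL' θ.b₀ θ.b₁ Mstar, ∀ α₀ : ℝ, 0 < α₀ → (geo9Y x).M * α₀ ≤ aT →
        ∀ U : (bg9Y (Matrix (Fin N) (Fin N) ℂ) (specialUnitaryUnits (Fin N)) x).Cfg,
          (bg9Y (Matrix (Fin N) (Fin N) ℂ) (specialUnitaryUnits (Fin N)) x).Reg335 c35 α₀ U → BaseLassoSmall x.toKIdx U ω) :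
    ∃ Mt aT C : ℝ, 0 < Mt ∧ 0 < aT ∧ 0 < C ∧
      ∀ x : MemberY θ.d₆ θ.ℓ₆ θ.hd' θ.hL' θ.b₀ θ.b₁ Mstar, Mt ≤ (geo9Y x).M → ∀ α₀ : ℝ, 0 < α₀ → (geo9Y x).M * α₀ ≤ aT →
        ∀ U : (bg9Y (Matrix (Fin N) (Fin N) ℂ) (specialUnitaryUnits (Fin N)) x).Cfg,
          (bg9Y (Matrix (Fin N) (Fin N) ℂ) (specialUnitaryUnits (Fin N)) x).Reg335 c35 α₀ U → (bg9Y (Matrix (Fin N) (Fin N) ℂ) (specialUnitaryUnits (Fin N)) x).Reg336 c35 α₀ U →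
            ∀ Ψ : IBondY x.toKIdx → Matrix (Fin N) (Fin N) ℂ,
              B9Thm311ReadingCoords.trIP (fun _ => (1 : ℝ)) (B9Eq3132TentOperator.tentOp x.toKIdx (B9Eq3132ApproxRightInverse.bumpProfile x.toKIdx) U Ψ)
                  (deltaAY x.toKIdx (parSymY x.toKIdx) (parBY x.toKIdx) (GpY x.toKIdx (parSymY x.toKIdx)) U
                    (B9Eq3132TentOperator.tentOp x.toKIdx (B9Eq3132ApproxRightInverse.bumpProfile x.toKIdx) U Ψ)) ≤
                C * B9Thm311ReadingCoords.trIP (fun _ => (1 : ℝ)) Ψ Ψ := by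
  obtain ⟨aT, ω, haT, hW⟩ := hWl
  -- the plaquette constant: `ϖ := ϖ(|c|·aT)` serves every member (a regular background forces `0 < c`)
  refine B9Eq3132EnergyOfTents.hP1_of_transport θ Mstar ⟨aT, ω, varpi (|c35| * aT), haT, varpi_nonneg (by positivity), fun x α₀ hα hMa U h335 => ⟨hW x α₀ hα hMa U h335, ?_⟩⟩
  rcases isEmpty_or_nonempty (Fin N) with hN | hN
  · exact basePlaqSmall_of_isEmpty x.toKIdx U (varpi_nonneg (by positivity))
  · have hpos := reg335_const_pos x.toKIdx h335.1
    have hc : 0 < c35 := by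
      have : 0 < c35 * ((kGeo x.toKIdx).M * α₀) := by rw [← mul_assoc]; exact hpos
      exact pos_of_mul_pos_left this (mul_pos (M_pos x.toKIdx) hα).le
    rw [show |c35| = c35 from abs_of_pos hc]
    exact plaqSmall_member_of_reg335 x hα hMa h335

/-! ## §4 (v1.1, appended) Monotonicity of (hP) in its constant -/

/-- (hP) is monotone in the plaquette constant: `BasePlaqSmall U ϖ → ϖ ≤ ϖ' → BasePlaqSmall U ϖ'`. [cite: Balaban1985BackgroundPropagators, (3.69) p.404, bookkeeping] -/
theorem basePlaqSmall_mono {U : CfgY (Matrix (Fin N) (Fin N) ℂ) i} {ϖ ϖ' : ℝ} (h : BasePlaqSmall i U ϖ) (hle : ϖ ≤ ϖ') : BasePlaqSmall i U ϖ' :=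
  fun y p h₁ h₂ h₃ => (h y p h₁ h₂ h₃).trans (mul_le_mul_of_nonneg_right hle (pow_nonneg (inv_nonneg.2 (B9Eq3132TentBumps.sideY_pos i y).le) 2))

end Literature.MathematicalPhysics.QuantumFieldTheory.Balaban1983to89.B9Eq3132TentPlaquettes

end
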